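import Literature.NumberTheory.NumberFields.CyclicQuinticField11Model
import Literature.NumberTheory.NumberFields.SelmerGroupPID
import Literature.NumberTheory.EllipticCurves.TwoDescentParity
import HarnessLib

/-!
# The cyclic quintic field of conductor `11`: the norm-`1` `2`-descent of `480a1` over `K`

Let `K = ℚ(θ)`, `θ⁵ + θ⁴ - 4θ³ - 3θ² + 3θ + 1 = 0`, be `ℚ(ζ₁₁)⁺` (`CyclicQuinticField11*.lean`:
`𝓞 K = ℤ[θ]`, `Gal = ⟨σ⟩`, five real places, units `η_i = σⁱθ` modulo squares, `2, 3, 5` inert, class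
number one; `CyclicQuinticField11Model.lean`: the quotient `𝓞 K/4` as the computable ring
`QuinticRing (ZMod 4) 3 1 3 0 3` and the finite checks). The main result of this file is

* `normDescent`: if `(x, y) ∈ K²` satisfies `y² = x(x+2)(x-3)` with `y ≠ 0` and both `N_{K/ℚ}(x)` and
  `N_{K/ℚ}(x+2)` are squares in `ℚ`, then `x` and `x + 2` are squares in `K`;

and its transport `normDescent_of_root` to ANY quintic extension `K'/ℚ` containing a root of `f` (the
form in which the field occurs as a subfield of `ℚ(ζ₂₆₅₁)`). In other words, the norm-`1` part of the
image of the complete `2`-descent map `P ↦ (x - e₁, x - e₂) ∈ K(S,2)²` [SilvermanAEC2009, Ch. X §1,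
Prop. X.1.4] of `480a1 : y² = x(x+2)(x-3)` over `K` is trivial outside the `2`-torsion; combined with
`Literature.Barriers.BirchSwinnertonDyer.DokchitserDokchitser2011_rank_480a1_F5_of_quintic_normDescent`
this is the statement `rk 480a1(K) = rk 480a1(ℚ) = 1` for the conductor-`11` subfield of the field `F₅`
of [DokchitserDokchitser2011RankModN, proof of Thm. 2] (where the ranks are obtained by a Magma
`2`-descent over the minimal subfields of `F₅`). The argument, the `n = 5` analogue of the tree's
`CyclicCubicField13Descent.lean`, is (all [folklore] given the cited method):

1. *Even valuations everywhere.* Off the primes above `2·3` (for `x`) resp. `2·5` (for `x + 2`) by the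
   valuation parity lemma of the `2`-descent (`Literature.NumberTheory.EllipticCurves.TwoDescentParity`);
   at the INERT primes `(2)`, `(3)`, `(5)` from the norm hypothesis, since a `σ`-invariant valuation
   takes the same value on the five conjugates (`two_dvd_log_valuation_of_isSquare_norm`:
   `5·ord(z) = 2·ord(r)`).
2. *Representatives.* `h(K) = 1` and `𝓞ˣ/𝓞ˣ² = {∏ η_i^{b_i}}` give `x = u A²`, `x + 2 = u' B²` with
   `u = rep n`, `u' = rep n'`; `N(x) = □` forces the weight of `n` to be even.
3. *Real places.* `x + 2` is totally positive, so `u' ≫ 0`, so `n' = 0`: **`x + 2 = B²`**.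
4. *The prime `2`* (modulo `4`, not `8`): with `x - 3 = u C²`, `C = y/(uAB)`, according to
   `ord₂(A) > 0`, `= 0`, `< 0` one gets `ord₂(x+2) = 1` odd, resp. `uS + 2 = S'`, `uS - 3 = uS''`
   (`no_solution_main`), resp. `uS = S'` (`no_solution_neg`) in `𝓞/4` with odd squares `S, S'`, after
   clearing odd integral denominators (`exists_odd_int_mul_eq`: `N(s) = ∏ σⁱ s` is odd for `s ∉ (2)`).
   Every `u = rep n ≠ 1` (fifteen classes) is excluded, hence `x = A²`.

## Contents

`v₂, v₃, v₅`, `σint` and the invariance of the inert valuations, the norm-parity lemma, the real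
positivity of `x + 2`, the curve section (even valuations, `exists_rep_mul_sq_x`, `x_add_two_eq_sq`),
the `2`-adic section, the assembly `normDescent`, and the transport (`algEquivOfRoot`,
`normDescent_of_root`). No named facts are introduced.
-/

noncomputable section

open Polynomial NumberField Algebra Ideal IsDedekindDomain IsDedekindDomain.HeightOneSpectrum
open scoped WithZero

namespace Literature.NumberTheory.NumberFields

namespace CyclicQuintic11

/-! ### The inert places `(2)`, `(3)`, `(5)` as points of `HeightOneSpectrum` -/

/-- A prime `P` of `𝓞 K` containing the rational prime `p` lies over `(p) ⊂ ℤ`. [folklore] -/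
theorem mem_primesOver_of_mem {p : ℕ} (hp : p.Prime) {P : Ideal (𝓞 K)} [hP : P.IsPrime]
    (hmem : (p : 𝓞 K) ∈ P) : P ∈ primesOver (span {(p : ℤ)}) (𝓞 K) := by
  haveI : Fact p.Prime := ⟨hp⟩
  refine ⟨hP, ⟨?_⟩⟩
  refine (Int.ideal_span_isMaximal_of_prime p).eq_of_le (Ideal.comap_ne_top _ hP.ne_top) ?_
  rw [Ideal.span_singleton_le_iff_mem, Ideal.mem_comap, map_natCast]
  exact hmem

/-- **The prime `v₂ = (2)`.** [folklore] -/
def v₂ : HeightOneSpectrum (𝓞 K) := ⟨span {(2 : 𝓞 K)}, span_two.1, by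
  rw [Ne, span_singleton_eq_bot]; norm_num⟩

/-- **The prime `v₃ = (3)`.** [folklore] -/
def v₃ : HeightOneSpectrum (𝓞 K) := ⟨span {(3 : 𝓞 K)}, span_three.1, by
  rw [Ne, span_singleton_eq_bot]; norm_num⟩

/-- **The prime `v₅ = (5)`.** [folklore] -/
def v₅ : HeightOneSpectrum (𝓞 K) := ⟨span {(5 : 𝓞 K)}, span_five.1, by
  rw [Ne, span_singleton_eq_bot]; norm_num⟩

/-- A point of the height-one spectrum containing `2` is `v₂`. [folklore] -/
theorem eq_v₂_of_mem {v : HeightOneSpectrum (𝓞 K)} (h : (2 : 𝓞 K) ∈ v.asIdeal) : v = v₂ := by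
  haveI := v.isPrime
  have := span_two.2.2 v.asIdeal (by simpa using mem_primesOver_of_mem Nat.prime_two (by simpa using h))
  exact HeightOneSpectrum.ext this

/-- A point of the height-one spectrum containing `3` is `v₃`. [folklore] -/
theorem eq_v₃_of_mem {v : HeightOneSpectrum (𝓞 K)} (h : (3 : 𝓞 K) ∈ v.asIdeal) : v = v₃ := by
  haveI := v.isPrime
  have := span_three.2.2 v.asIdeal (by simpa using mem_primesOver_of_mem Nat.prime_three (by simpa using h))
  exact HeightOneSpectrum.ext this

/-- A point of the height-one spectrum containing `5` is `v₅`. [folklore] -/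
theorem eq_v₅_of_mem {v : HeightOneSpectrum (𝓞 K)} (h : (5 : 𝓞 K) ∈ v.asIdeal) : v = v₅ := by
  haveI := v.isPrime
  have := span_five.2.2 v.asIdeal (by simpa using mem_primesOver_of_mem Nat.prime_five (by simpa using h))
  exact HeightOneSpectrum.ext this

/-- **Valuations of rational integers**: `v(n) = 1` unless `n ∈ v`. [folklore] -/
theorem valuation_natCast_eq_one_iff (v : HeightOneSpectrum (𝓞 K)) (n : ℕ) :
    v.valuation K (n : K) = 1 ↔ (n : 𝓞 K) ∉ v.asIdeal := by
  rw [show (n : K) = algebraMap (𝓞 K) K n by simp, valuation_of_algebraMap, intValuation_eq_one_iff]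

/-- `v(n) ≤ 1` for a natural number `n`. [folklore] -/
theorem valuation_natCast_le_one (v : HeightOneSpectrum (𝓞 K)) (n : ℕ) : v.valuation K (n : K) ≤ 1 := by
  rw [show (n : K) = algebraMap (𝓞 K) K n by simp]; exact valuation_le_one v _

/-! ### `σ` on `𝓞 K` and the invariance of the inert valuations -/

/-- **`σ` restricted to `𝓞 K`** (a ring automorphism). [folklore] -/
def σint : 𝓞 K ≃+* 𝓞 K := RingOfIntegers.mapRingEquiv σ.toRingEquiv

/-- `σint` is `σ` on `K`. [folklore] -/
@[simp] theorem coe_σint (a : 𝓞 K) : ((σint a : 𝓞 K) : K) = σ (a : K) := rfl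

/-- **A ring automorphism of `𝓞 K` does not increase the valuation at an inert prime `(p)`**: it
preserves divisibility by `pⁿ`. (Verbatim the tree's `CyclicCubic13.intValuation_ringEquiv_le`.)
[folklore] -/
theorem intValuation_ringEquiv_le (v : HeightOneSpectrum (𝓞 K)) {p : ℕ} (hv : v.asIdeal = span {(p : 𝓞 K)})
    (τ : 𝓞 K ≃+* 𝓞 K) (a : 𝓞 K) : v.intValuation (τ a) ≤ v.intValuation a := by
  by_cases ha : a = 0
  · simp [ha]
  have key : ∀ (b : 𝓞 K) (n : ℕ), v.intValuation b ≤ WithZero.exp (-(n : ℤ)) ↔ (p : 𝓞 K) ^ n ∣ b := by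
    intro b n
    rw [intValuation_le_pow_iff_dvd, hv, Ideal.span_singleton_pow, dvd_span_singleton,
      Ideal.mem_span_singleton]
  have hva : v.intValuation a ≠ 0 := intValuation_ne_zero v a ha
  obtain ⟨m, hm⟩ : ∃ m : ℕ, v.intValuation a = WithZero.exp (-(m : ℤ)) := by
    have hle : WithZero.log (v.intValuation a) ≤ 0 := by
      rw [← WithZero.log_one]
      exact (WithZero.log_le_log hva one_ne_zero).mpr (intValuation_le_one v a)
    refine ⟨(-WithZero.log (v.intValuation a)).toNat, ?_⟩
    rw [Int.toNat_of_nonneg (by omega), neg_neg, WithZero.exp_log hva]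
  rw [hm, key]
  have h := (key a m).mp hm.le
  simpa using map_dvd τ h

/-- Hence `v_{(p)}(τ a) = v_{(p)}(a)` for a ring automorphism `τ` of `𝓞 K` and an inert `p`.
[folklore] -/
theorem intValuation_ringEquiv_eq (v : HeightOneSpectrum (𝓞 K)) {p : ℕ} (hv : v.asIdeal = span {(p : 𝓞 K)})
    (τ : 𝓞 K ≃+* 𝓞 K) (a : 𝓞 K) : v.intValuation (τ a) = v.intValuation a := by
  refine le_antisymm (intValuation_ringEquiv_le v hv τ a) ?_
  have := intValuation_ringEquiv_le v hv τ.symm (τ a)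
  rwa [τ.symm_apply_apply] at this

/-- **`σ` preserves the valuation of `K` at an inert prime `(p)`.** [folklore] -/
theorem valuation_σ_eq (v : HeightOneSpectrum (𝓞 K)) {p : ℕ} (hv : v.asIdeal = span {(p : 𝓞 K)}) (z : K) :
    v.valuation K (σ z) = v.valuation K z := by
  obtain ⟨a, b, hb, rfl⟩ := IsFractionRing.div_surjective (A := 𝓞 K) z
  have e : σ (algebraMap (𝓞 K) K a / algebraMap (𝓞 K) K b) =
      algebraMap (𝓞 K) K (σint a) / algebraMap (𝓞 K) K (σint b) := by
    rw [map_div₀]; rfl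
  rw [e, map_div₀, map_div₀, valuation_of_algebraMap, valuation_of_algebraMap, valuation_of_algebraMap,
    valuation_of_algebraMap, intValuation_ringEquiv_eq v hv, intValuation_ringEquiv_eq v hv]

/-- The same for the iterates `σⁱ`. [folklore] -/
theorem valuation_σ_iterate_eq (v : HeightOneSpectrum (𝓞 K)) {p : ℕ} (hv : v.asIdeal = span {(p : 𝓞 K)})
    (n : ℕ) (z : K) : v.valuation K (σ^[n] z) = v.valuation K z := by
  induction n with
  | zero => rfl
  | succ n ih => rw [Function.iterate_succ_apply', valuation_σ_eq v hv, ih]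

/-- **Norm parity at an inert prime**: if `N_{K/ℚ}(z)` is the square of a rational number then
`ord_{(p)}(z)` is even, for `p = 2, 3, 5` inert in `K`: `N(z) = ∏_{i<5} σⁱz` has
`ord_{(p)}(N z) = 5 ord_{(p)}(z)` and `ord_{(p)}(r²) = 2 ord_{(p)}(r)`. [folklore] -/
theorem two_dvd_log_valuation_of_isSquare_norm (v : HeightOneSpectrum (𝓞 K)) {p : ℕ}
    (hv : v.asIdeal = span {(p : 𝓞 K)}) {z : K} (hz : z ≠ 0) (h : IsSquare (Algebra.norm ℚ z)) :
    (2 : ℤ) ∣ WithZero.log (v.valuation K z) := by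
  obtain ⟨r, hr⟩ := h
  have hN := norm_eq_prod_pow_σ z
  rw [hr, map_mul] at hN
  set w := v.valuation K with hw
  have hσz : ∀ i : Fin 5, (σ ^ (i : ℕ)) z ≠ 0 := fun i => (_root_.map_ne_zero _).mpr hz
  have hprod : ∏ i : Fin 5, (σ ^ (i : ℕ)) z ≠ 0 := Finset.prod_ne_zero_iff.mpr fun i _ => hσz i
  have hr0 : (algebraMap ℚ K r) ≠ 0 := by
    intro h0
    rw [h0, zero_mul] at hN
    exact hprod hN.symm
  have hv0 : w z ≠ 0 := (Valuation.ne_zero_iff _).mpr hz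
  have hvr : w (algebraMap ℚ K r) ≠ 0 := (Valuation.ne_zero_iff _).mpr hr0
  have hwi : ∀ i : Fin 5, w ((σ ^ (i : ℕ)) z) = w z := fun i => by
    rw [hw, σ_pow_apply, valuation_σ_iterate_eq v hv]
  have key : WithZero.log (w (algebraMap ℚ K r * algebraMap ℚ K r)) =
      WithZero.log (w (∏ i : Fin 5, (σ ^ (i : ℕ)) z)) := by rw [hN]
  rw [map_mul, WithZero.log_mul hvr hvr, map_prod] at key
  simp_rw [hwi] at key
  rw [Finset.prod_const, Finset.card_univ, Fintype.card_fin, WithZero.log_pow] at key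
  exact ⟨3 * WithZero.log (w z) - WithZero.log (w (algebraMap ℚ K r)), by
    simp only [nsmul_eq_mul, Nat.cast_ofNat] at key; linarith⟩

/-! ### The real places: `x + 2` is totally positive -/

/-- **On the real curve `Y² = X(X+2)(X-3)` with `Y ≠ 0` one has `X + 2 > 0`** (the cubic is positive
exactly on `(-2, 0) ∪ (3, ∞)`). (Verbatim the tree's `CyclicCubic13.real_x_add_two_pos`.) [folklore] -/
theorem real_x_add_two_pos {X Y : ℝ} (h : Y ^ 2 = X * (X + 2) * (X - 3)) (hY : Y ≠ 0) : 0 < X + 2 := by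
  by_contra hle
  rw [not_lt] at hle
  have hX : X ≤ -2 := by linarith
  have h1 : 0 < X * (X - 3) := by nlinarith
  have h2 : X * (X + 2) * (X - 3) = (X + 2) * (X * (X - 3)) := by ring
  have h3 : 0 < Y ^ 2 := lt_of_le_of_ne (sq_nonneg Y) (Ne.symm (pow_ne_zero 2 hY))
  nlinarith

/-- **`x + 2` is positive at every real place** for a `K`-point of `y² = x(x+2)(x-3)` with `y ≠ 0`.
[folklore] -/
theorem e_x_add_two_pos {x y : K} (hE : y ^ 2 = x * (x + 2) * (x - 3)) (hy : y ≠ 0) (k : Fin 5) :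
    0 < e k (x + 2) := by
  rw [map_add, map_ofNat]
  refine real_x_add_two_pos (Y := e k y) ?_ ((_root_.map_ne_zero (e k)).mpr hy)
  have := congrArg (e k) hE
  simpa [map_pow, map_mul, map_add, map_sub, map_ofNat] using this

/-! ### Units and valuations -/

/-- The valuation of a unit of `𝓞 K` is `1` at every finite place. [folklore] -/
theorem valuation_coe_unit (v : HeightOneSpectrum (𝓞 K)) (u : (𝓞 K)ˣ) : v.valuation K (((u : 𝓞 K)) : K) = 1 := by
  rw [RingOfIntegers.coe_eq_algebraMap, valuation_of_algebraMap, intValuation_eq_one_iff]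
  exact fun h => v.isPrime.ne_top (Ideal.eq_top_of_isUnit_mem _ h u.isUnit)

/-- A unit of `𝓞 K` is not in the prime `(2)`. [folklore] -/
theorem unit_not_mem_span_two (u : (𝓞 K)ˣ) : ((u : 𝓞 K)) ∉ span {(2 : 𝓞 K)} := fun h =>
  (span_two.1).ne_top (Ideal.eq_top_of_isUnit_mem _ h u.isUnit)

/-- `rep 0 = 1`. [folklore] -/
theorem rep_zero : rep 0 = 1 := by
  simp [rep, bit]

/-- **`K(∅, 2) = 𝓞ˣ/𝓞ˣ² = {rep n}`**: a non-zero `z ∈ K` all of whose valuations are even is `rep n · w²`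
(class number one: the tree's `exists_isSquare_mul_of_two_dvd_log_valuation` with `D = 1`; units modulo
squares: `exists_eq_rep_mul_sq`). [folklore] -/
theorem exists_rep_mul_sq_of_two_dvd_log_valuation {z : K} (hz : z ≠ 0)
    (hval : ∀ v : HeightOneSpectrum (𝓞 K), (2 : ℤ) ∣ WithZero.log (v.valuation K z)) :
    ∃ (n : Fin 32) (w : K), w ≠ 0 ∧ z = (((rep n : (𝓞 K)ˣ) : 𝓞 K) : K) * w ^ 2 := by
  obtain ⟨u, l, hlG, -, r, hr⟩ :=
    Literature.NumberTheory.NumberFields.exists_isSquare_mul_of_two_dvd_log_valuation (1 : 𝓞 K) List.nil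
    (fun q hq hd => (hq.not_unit (isUnit_of_dvd_one hd)).elim) hz (fun v _ => hval v)
  have hl : l = List.nil := List.eq_nil_iff_forall_not_mem.mpr fun g hg => by simpa using hlG g hg
  subst hl
  simp only [List.prod_nil] at hr
  rw [show (((1 : 𝓞 K)) : K) = 1 from rfl, mul_one] at hr
  -- `z u = r²`, `u⁻¹ = rep n η²`
  obtain ⟨n, η, hu⟩ := exists_eq_rep_mul_sq u⁻¹
  have hu' : (((u⁻¹ : (𝓞 K)ˣ) : 𝓞 K) : K) = (((rep n : (𝓞 K)ˣ) : 𝓞 K) : K) * ((((η : (𝓞 K)ˣ) : 𝓞 K) : K)) ^ 2 := by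
    rw [hu]; simp only [Units.val_mul, Units.val_pow_eq_pow_val]; push_cast; ring
  have huu : (((u : (𝓞 K)ˣ) : 𝓞 K) : K) * (((u⁻¹ : (𝓞 K)ˣ) : 𝓞 K) : K) = 1 := by
    have h1 : ((((u * u⁻¹ : (𝓞 K)ˣ)) : 𝓞 K) : K) = 1 := by rw [mul_inv_cancel]; rfl
    push_cast at h1
    exact h1
  refine ⟨n, (((η : (𝓞 K)ˣ) : 𝓞 K) : K) * r, ?_, ?_⟩
  · intro h0
    apply hz
    have : z * (((u : (𝓞 K)ˣ) : 𝓞 K) : K) = 0 := by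
      rw [hr]
      rcases mul_eq_zero.mp h0 with h | h
      · exfalso
        exact (RingOfIntegers.coe_ne_zero_iff.mpr (Units.ne_zero η)) h
      · rw [h, mul_zero]
    rcases mul_eq_zero.mp this with h | h
    · exact h
    · exact absurd h (RingOfIntegers.coe_ne_zero_iff.mpr (Units.ne_zero u))
  · calc z = z * ((((u : (𝓞 K)ˣ) : 𝓞 K) : K) * (((u⁻¹ : (𝓞 K)ˣ) : 𝓞 K) : K)) := by rw [huu, mul_one]
      _ = (z * (((u : (𝓞 K)ˣ) : 𝓞 K) : K)) * (((u⁻¹ : (𝓞 K)ˣ) : 𝓞 K) : K) := by ring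
      _ = _ := by rw [hr, hu']; ring

/-! ### The curve `480a1 : y² = x(x + 2)(x - 3)` over `K`: even valuations -/

section Curve

variable {x y : K} (hE : y ^ 2 = x * (x + 2) * (x - 3)) (hy : y ≠ 0)
include hE hy

/-- `x ≠ 0`, `x + 2 ≠ 0`, `x - 3 ≠ 0` for a point with `y ≠ 0`. [folklore] -/
theorem x_ne : x ≠ 0 ∧ x + 2 ≠ 0 ∧ x - 3 ≠ 0 := by
  have h : x * (x + 2) * (x - 3) ≠ 0 := by rw [← hE]; exact pow_ne_zero 2 hy
  exact ⟨fun h0 => h (by rw [h0]; ring), fun h0 => h (by rw [h0]; ring), fun h0 => h (by rw [h0]; ring)⟩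

/-- **`ord_v(x)` is even for every finite place `v`**: off `2, 3` by the valuation parity lemma of
the `2`-descent (`Valuation.two_dvd_log_map_sub_of_sq_eq`, `e = (0, -2, 3)`), and at the inert primes
`(2)`, `(3)` by the norm condition `N(x) = □`. [folklore] -/
theorem two_dvd_log_valuation_x (hN : IsSquare (Algebra.norm ℚ x)) (v : HeightOneSpectrum (𝓞 K)) :
    (2 : ℤ) ∣ WithZero.log (v.valuation K x) := by
  obtain ⟨hx0, -, -⟩ := x_ne hE hy
  by_cases h2 : (2 : 𝓞 K) ∈ v.asIdeal
  · rw [eq_v₂_of_mem h2]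
    exact two_dvd_log_valuation_of_isSquare_norm v₂ (p := 2) (by simp [v₂]) hx0 hN
  by_cases h3 : (3 : 𝓞 K) ∈ v.asIdeal
  · rw [eq_v₃_of_mem h3]
    exact two_dvd_log_valuation_of_isSquare_norm v₃ (p := 3) (by simp [v₃]) hx0 hN
  have hv2 : v.valuation K (2 : K) = 1 := by exact_mod_cast (valuation_natCast_eq_one_iff v 2).mpr (by exact_mod_cast h2)
  have hv3 : v.valuation K (3 : K) = 1 := by exact_mod_cast (valuation_natCast_eq_one_iff v 3).mpr (by exact_mod_cast h3)
  have key := (v.valuation K).two_dvd_log_map_sub_of_sq_eq (e₁ := 0) (e₂ := -2) (e₃ := 3) (x := x) (y := y)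
    (by rw [map_zero]; exact zero_le_one) (by simp only [Valuation.map_neg, hv2, le_refl]) (by rw [hv3])
    (by simp only [zero_sub, Valuation.map_neg, hv2]) (by simp only [zero_sub, Valuation.map_neg, hv3]) hx0
    (by rw [hE]; ring)
  rwa [sub_zero] at key

/-- **`ord_v(x + 2)` is even for every finite place `v`**: off `2, 5` by the parity lemma
(`e = (-2, 0, 3)`), at the inert primes `(2)`, `(5)` by `N(x + 2) = □`. [folklore] -/
theorem two_dvd_log_valuation_x_add_two (hN : IsSquare (Algebra.norm ℚ (x + 2))) (v : HeightOneSpectrum (𝓞 K)) :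
    (2 : ℤ) ∣ WithZero.log (v.valuation K (x + 2)) := by
  obtain ⟨hx0, hx2, -⟩ := x_ne hE hy
  by_cases h2 : (2 : 𝓞 K) ∈ v.asIdeal
  · rw [eq_v₂_of_mem h2]
    exact two_dvd_log_valuation_of_isSquare_norm v₂ (p := 2) (by simp [v₂]) hx2 hN
  by_cases h5 : (5 : 𝓞 K) ∈ v.asIdeal
  · rw [eq_v₅_of_mem h5]
    exact two_dvd_log_valuation_of_isSquare_norm v₅ (p := 5) (by simp [v₅]) hx2 hN
  have hv2 : v.valuation K (2 : K) = 1 := by exact_mod_cast (valuation_natCast_eq_one_iff v 2).mpr (by exact_mod_cast h2)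
  have hv5 : v.valuation K (5 : K) = 1 := by exact_mod_cast (valuation_natCast_eq_one_iff v 5).mpr (by exact_mod_cast h5)
  have hv3 : v.valuation K (3 : K) ≤ 1 := by exact_mod_cast valuation_natCast_le_one v 3
  have key := (v.valuation K).two_dvd_log_map_sub_of_sq_eq (e₁ := -2) (e₂ := 0) (e₃ := 3) (x := x) (y := y)
    (by simp only [Valuation.map_neg, hv2, le_refl]) (by rw [map_zero]; exact zero_le_one) hv3
    (by simp only [sub_zero, Valuation.map_neg, hv2])
    (by rw [show (-2 : K) - 3 = -5 by norm_num]; simp only [Valuation.map_neg, hv5])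
    (by rw [Ne, ← sub_eq_zero, sub_neg_eq_add]; exact hx2) (by rw [hE]; ring)
  rwa [sub_neg_eq_add] at key

/-- **`x = u A²` with `u = rep n` of even weight** (all valuations of `x` are even, `h_K = 1`, units
modulo squares; `N(x) = (-1)^{Σ bit n i} N(A)²` is a rational square only if the weight is even).
[folklore] -/
theorem exists_rep_mul_sq_x (hN : IsSquare (Algebra.norm ℚ x)) :
    ∃ (n : Fin 32) (A : K), A ≠ 0 ∧ x = (((rep n : (𝓞 K)ˣ) : 𝓞 K) : K) * A ^ 2 ∧
      2 ∣ bit n 0 + bit n 1 + bit n 2 + bit n 3 + bit n 4 := by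
  obtain ⟨hx0, -, -⟩ := x_ne hE hy
  obtain ⟨n, A, hA, hxA⟩ := exists_rep_mul_sq_of_two_dvd_log_valuation hx0
    (two_dvd_log_valuation_x hE hy hN)
  refine ⟨n, A, hA, hxA, ?_⟩
  rw [← sum_bit_eq]
  have hNx : Algebra.norm ℚ x = (-1) ^ (∑ i, bit n i) * (Algebra.norm ℚ A) ^ 2 := by
    rw [hxA, map_mul, map_pow, norm_rep]
  have hq : Algebra.norm ℚ A ≠ 0 := Algebra.norm_ne_zero_iff.mpr hA
  by_contra hodd
  rw [(Nat.not_even_iff_odd.mp (fun h => hodd (even_iff_two_dvd.mp h))).neg_one_pow] at hNx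
  have hlt : Algebra.norm ℚ x < 0 := by rw [hNx]; nlinarith [sq_pos_iff.mpr hq]
  linarith [hN.nonneg]

/-- **`x + 2 = B²`**: `x + 2 = u' B²` with a unit representative `u' = rep n'` (even valuations,
`h_K = 1`), and `x + 2` is positive at all five real places, so `u'` is totally positive, so `n' = 0`.
[folklore] -/
theorem x_add_two_eq_sq (hN : IsSquare (Algebra.norm ℚ (x + 2))) : ∃ B : K, B ≠ 0 ∧ x + 2 = B ^ 2 := by
  obtain ⟨-, hx2, -⟩ := x_ne hE hy
  obtain ⟨n, B, hB, hxB⟩ := exists_rep_mul_sq_of_two_dvd_log_valuation hx2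
    (two_dvd_log_valuation_x_add_two hE hy hN)
  have hn : n = 0 := by
    refine rep_eq_zero_of_pos fun k => ?_
    have hpos := e_x_add_two_pos hE hy k
    rw [hxB, map_mul, map_pow] at hpos
    have hB2 : 0 < (e k B) ^ 2 := lt_of_le_of_ne (sq_nonneg _) (Ne.symm (pow_ne_zero 2 ((_root_.map_ne_zero _).mpr hB)))
    exact (mul_pos_iff_of_pos_right hB2).mp hpos
  subst hn
  refine ⟨B, hB, ?_⟩
  rw [hxB, rep_zero]; simp

end Curve

/-! ### The `2`-adic obstruction: reduction to `𝓞/4` -/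

section TwoAdic

variable (ψ : 𝓞 K →+* Q4)

/-- An element of `𝓞 K` outside `(2)` has odd image in `𝓞/4`. [folklore] -/
theorem isOdd_of_not_mem {z : 𝓞 K} (hz : z ∉ span {(2 : 𝓞 K)}) : IsOdd (ψ z) :=
  isOdd_of_not_two_dvd ψ (by rwa [Ideal.mem_span_singleton] at hz)

/-- `4 = 0` in `𝓞/4`. [folklore] -/
theorem four_eq_zero : (4 : Q4) = 0 := by decide +kernel

/-- **Core of case `ord₂(x) = 0`.** If `α u² + 2e² = w²` and `α u² - 3e² = α c²` in `𝓞 K` with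
`u, w ∉ (2)`, `ψ(e)² = 1` and `ψ α = repQ n` a candidate, contradiction (`no_solution_main`). [folklore] -/
theorem core_main {αO u w c e : 𝓞 K} {n : Fin 32} (hn : n ∈ candN) (hα : ψ αO = repQ n)
    (hu : u ∉ span {(2 : 𝓞 K)}) (hw : w ∉ span {(2 : 𝓞 K)}) (he : ψ e * ψ e = 1)
    (h1 : αO * u ^ 2 + 2 * e ^ 2 = w ^ 2) (h2 : αO * u ^ 2 - 3 * e ^ 2 = αO * c ^ 2) : False := by
  have e1 := congrArg ψ h1
  have e2 := congrArg ψ h2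
  simp only [map_add, map_sub, map_mul, map_ofNat, pow_two, he, mul_one, hα] at e1 e2
  exact no_solution_main hn (sq_mem_oddSq4 _ (isOdd_of_not_mem ψ hu)) (sq_mem_oddSq4 _ (isOdd_of_not_mem ψ hw))
    (sq_mem_sq4 (ψ c)) e1 e2

/-- **Core of case `ord₂(x) < 0`**: `α u² + 2·4^M e² = w²` (`M ≥ 1`) with `u, w ∉ (2)` and `ψ α` a
candidate: contradiction (`no_solution_neg`; `4^M = 0` in `𝓞/4`). [folklore] -/
theorem core_neg {αO u w e : 𝓞 K} {n : Fin 32} (hn : n ∈ candN) (hα : ψ αO = repQ n)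
    (hu : u ∉ span {(2 : 𝓞 K)}) (hw : w ∉ span {(2 : 𝓞 K)}) {M : ℕ} (hM : 1 ≤ M)
    (h1 : αO * u ^ 2 + 2 * 4 ^ M * e ^ 2 = w ^ 2) : False := by
  have e1 := congrArg ψ h1
  have h4M : (4 : Q4) ^ M = 0 := by
    obtain ⟨m, rfl⟩ := Nat.exists_eq_add_of_le hM
    rw [pow_add, pow_one, four_eq_zero, zero_mul]
  simp only [map_add, map_mul, map_pow, map_ofNat, pow_two, h4M, mul_zero, zero_mul, add_zero, hα] at e1
  exact no_solution_neg hn (sq_mem_oddSq4 _ (isOdd_of_not_mem ψ hu)) (sq_mem_oddSq4 _ (isOdd_of_not_mem ψ hw)) e1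

/-- An odd rational integer is not in `(2) ⊂ 𝓞 K` (reduce `d = 2e` modulo `2` via `red42 ∘ ψ`).
[folklore] -/
theorem intCast_not_mem_span_two (ψ : 𝓞 K →+* Q4) {d : ℤ} (hd : Odd d) :
    ((d : ℤ) : 𝓞 K) ∉ span {(2 : 𝓞 K)} := by
  intro hmem
  rw [Ideal.mem_span_singleton] at hmem
  obtain ⟨e, he⟩ := hmem
  obtain ⟨k, rfl⟩ := hd
  have h := congrArg (red42.comp ψ) he
  simp only [RingHom.comp_apply, map_intCast, map_mul, map_ofNat] at h
  have h2 : (2 : Q2) = 0 := by decide +kernel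
  rw [h2, zero_mul] at h
  have h1 : ((2 * k + 1 : ℤ) : Q2) = 1 := by
    push_cast
    rw [h2, zero_mul, zero_add]
  rw [h1] at h
  exact absurd h (by decide +kernel)

/-- For an odd integer `d`, `ψ(d)² = 1` in `𝓞/4` (`(2k+1)² = 4(k² + k) + 1 ≡ 1 (mod 4)`). [folklore] -/
theorem ψ_intCast_sq_eq_one {d : ℤ} (hd : Odd d) : ψ (d : 𝓞 K) * ψ (d : 𝓞 K) = 1 := by
  obtain ⟨k, rfl⟩ := hd
  rw [map_intCast]
  have e : ((2 * k + 1 : ℤ) : Q4) * ((2 * k + 1 : ℤ) : Q4) = 4 * ((k * k + k : ℤ) : Q4) + 1 := by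
    push_cast; ring
  rw [e, four_eq_zero, zero_mul, zero_add]

/-- `σint` preserves non-membership in `(2)`. [folklore] -/
theorem σint_not_mem_span_two {s : 𝓞 K} (hs : s ∉ span {(2 : 𝓞 K)}) : σint s ∉ span {(2 : 𝓞 K)} := by
  have hv2 : v₂.asIdeal = span {((2 : ℕ) : 𝓞 K)} := by simp [v₂]
  have h1 : v₂.intValuation (σint s) = v₂.intValuation s := intValuation_ringEquiv_eq v₂ hv2 σint s
  intro hmem
  apply hs
  have : v₂.intValuation (σint s) < 1 := (intValuation_lt_one_iff_mem _ _).mpr hmem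
  rw [h1] at this
  exact (intValuation_lt_one_iff_mem _ _).mp this

/-- The norm of `s ∈ 𝓞 K` as an element of `𝓞 K`: `N(s) = ∏_{i<5} σⁱ s`. [folklore] -/
theorem intCast_norm_eq (s : 𝓞 K) :
    ((Algebra.norm ℤ s : ℤ) : 𝓞 K) =
      s * σint s * σint (σint s) * σint (σint (σint s)) * σint (σint (σint (σint s))) := by
  apply RingOfIntegers.coe_injective
  have h := norm_eq_prod_σ (s : K)
  rw [← Algebra.coe_norm_int s, eq_ratCast, Rat.cast_intCast] at h
  calc (((Algebra.norm ℤ s : ℤ) : 𝓞 K) : K) = ((Algebra.norm ℤ s : ℤ) : K) := by rfl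
    _ = (s : K) * σ (s : K) * σ (σ (s : K)) * σ (σ (σ (s : K))) * σ (σ (σ (σ (s : K)))) := h
    _ = ((s * σint s * σint (σint s) * σint (σint (σint s)) * σint (σint (σint (σint s))) : 𝓞 K) : K) := by
        push_cast
        simp only [coe_σint]

/-- A product of two elements outside the prime `(2)` is outside `(2)`. [folklore] -/
theorem mul_not_mem_span_two {a b : 𝓞 K} (ha : a ∉ span {(2 : 𝓞 K)}) (hb : b ∉ span {(2 : 𝓞 K)}) :
    a * b ∉ span {(2 : 𝓞 K)} := fun h => by
  rcases (span_two.1).mem_or_mem h with h1 | h2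
  · exact ha h1
  · exact hb h2

/-- **`2`-adic units of `K` have odd integral denominators.** If `v₂(z) ≤ 1` then `z · d = w` for some
`w ∈ 𝓞 K` and some ODD `d ∈ ℤ`, and `w ∉ (2)` when `v₂(z) = 1`: write `z = n/s` with `s ∉ (2)` and take
`d = N(s) = ∏ σⁱ s`, odd because `(2)` is a `σ`-stable prime. [folklore] -/
theorem exists_odd_int_mul_eq {z : K} (hz : v₂.valuation K z ≤ 1) :
    ∃ (w : 𝓞 K) (d : ℤ), Odd d ∧ z * (d : K) = (w : K) ∧ (v₂.valuation K z = 1 → w ∉ span {(2 : 𝓞 K)}) := by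
  obtain ⟨n, s, hns⟩ := exists_primeCompl_mul_eq_of_integer v₂ z hz
  have hs : (s : 𝓞 K) ∉ span {(2 : 𝓞 K)} := s.2
  haveI := span_two.1
  set c : 𝓞 K := σint s * σint (σint s) * σint (σint (σint s)) * σint (σint (σint (σint s))) with hc
  have hs1 := σint_not_mem_span_two hs
  have hs2 := σint_not_mem_span_two hs1
  have hs3 := σint_not_mem_span_two hs2
  have hs4 := σint_not_mem_span_two hs3
  have hcnot : c ∉ span {(2 : 𝓞 K)} :=
    mul_not_mem_span_two (mul_not_mem_span_two (mul_not_mem_span_two hs1 hs2) hs3) hs4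
  set d : ℤ := Algebra.norm ℤ (s : 𝓞 K) with hd
  have hdO : (d : 𝓞 K) = s * c := by rw [hc, intCast_norm_eq]; ring
  have hdnot : (d : 𝓞 K) ∉ span {(2 : 𝓞 K)} := by rw [hdO]; exact mul_not_mem_span_two hs hcnot
  have hodd : Odd d := by
    rw [← Int.not_even_iff_odd]
    rintro ⟨k, hk⟩
    apply hdnot
    rw [Ideal.mem_span_singleton]
    exact ⟨k, by rw [hk]; push_cast; ring⟩
  refine ⟨n * c, d, hodd, ?_, fun hz1 => ?_⟩
  · have e : (d : K) = (((d : 𝓞 K)) : K) := by rfl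
    rw [e, hdO]
    push_cast
    have hns' : z * ((s : 𝓞 K) : K) = (n : K) := hns
    linear_combination ((c : 𝓞 K) : K) * hns'
  · intro hmem
    rcases (span_two.1).mem_or_mem hmem with h1 | h2
    · have hvs : v₂.valuation K ((s : 𝓞 K) : K) = 1 := by
        rw [show ((s : 𝓞 K) : K) = algebraMap (𝓞 K) K s from rfl, valuation_of_algebraMap, intValuation_eq_one_iff]
        exact hs
      have hvn : v₂.valuation K ((n : 𝓞 K) : K) < 1 := by
        rw [show ((n : 𝓞 K) : K) = algebraMap (𝓞 K) K n from rfl, valuation_lt_one_iff_mem]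
        exact h1
      have : v₂.valuation K (z * ((s : 𝓞 K) : K)) = 1 := by rw [map_mul, hz1, hvs, mul_one]
      rw [show z * ((s : 𝓞 K) : K) = ((n : 𝓞 K) : K) from hns] at this
      exact absurd this hvn.ne
    · exact hcnot h2

/-- `v₂(2) = exp(-1)` (`(2)` is prime, so `2` is a uniformizer). [folklore] -/
theorem valuation_v₂_two : v₂.valuation K (2 : K) = WithZero.exp (-1) := by
  rw [← map_ofNat (algebraMap (𝓞 K) K) 2, valuation_of_algebraMap, v₂.intValuation_singleton (by norm_num) rfl]

/-- In `ℤᵐ⁰`, `log a ≤ 0 ↔ a ≤ 1` for `a ≠ 0`. [folklore] -/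
theorem log_nonpos_iff {a : ℤᵐ⁰} (ha : a ≠ 0) : WithZero.log a ≤ 0 ↔ a ≤ 1 := by
  rw [← WithZero.log_one]; exact WithZero.log_le_log ha one_ne_zero

/-- **The `2`-adic obstruction.** Let `α ∈ 𝓞 K ∖ (2)` with `ψ₄ α = repQ n` one of the fifteen
candidates, and suppose `x = α A²`, `x + 2 = B²` (`A, B ∈ Kˣ`) for a point `(x, y)`, `y ≠ 0`, of
`y² = x(x+2)(x-3)`. This is impossible: with `x - 3 = α C²`, `C = y/(αAB)`, according to
`ord₂(A) > 0`, `= 0`, `= -M < 0` one gets `ord₂(x + 2) = 1` odd, resp. the congruences of `core_main`,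
resp. `core_neg` modulo `4`, after clearing odd integral denominators (`exists_odd_int_mul_eq`).
[folklore] -/
theorem two_adic_obstruction {αO : 𝓞 K} (hα : αO ∉ span {(2 : 𝓞 K)}) {n : Fin 32} (hn : n ∈ candN)
    (hαψ : ψ αO = repQ n) {x y A B : K} (hE : y ^ 2 = x * (x + 2) * (x - 3)) (hy : y ≠ 0) (hA : A ≠ 0)
    (hB : B ≠ 0) (hxA : x = (αO : K) * A ^ 2) (hxB : x + 2 = B ^ 2) : False := by
  set v := v₂.valuation K with hv
  have hv2 : v 2 = WithZero.exp (-1) := valuation_v₂_two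
  have hv3 : v (3 : K) ≤ 1 := by exact_mod_cast valuation_natCast_le_one v₂ 3
  have hvα : v (αO : K) = 1 := by
    rw [hv, RingOfIntegers.coe_eq_algebraMap, valuation_of_algebraMap, intValuation_eq_one_iff]; exact hα
  have hα0 : ((αO : 𝓞 K) : K) ≠ 0 := fun h0 => by rw [h0, map_zero] at hvα; exact zero_ne_one hvα
  obtain ⟨hx0, hx2, hx3⟩ := x_ne hE hy
  -- the third coordinate `x - 3 = α C²`
  set C : K := y / (((αO : 𝓞 K) : K) * A * B) with hC
  have hden : ((αO : 𝓞 K) : K) * A * B ≠ 0 := mul_ne_zero (mul_ne_zero hα0 hA) hB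
  have hC0 : C ≠ 0 := div_ne_zero hy hden
  have key : y ^ 2 = (((αO : 𝓞 K) : K) * A ^ 2) * B ^ 2 * (x - 3) := by
    rw [← hxA, ← hxB]; exact hE
  have hxC : x - 3 = ((αO : 𝓞 K) : K) * C ^ 2 := by
    have hprod : ((αO : 𝓞 K) : K) * A ^ 2 * B ^ 2 ≠ 0 :=
      mul_ne_zero (mul_ne_zero hα0 (pow_ne_zero 2 hA)) (pow_ne_zero 2 hB)
    have hx3' : x - 3 = y ^ 2 / (((αO : 𝓞 K) : K) * A ^ 2 * B ^ 2) := by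
      rw [key, mul_div_cancel_left₀ _ hprod]
    rw [hx3', hC, div_pow]
    field_simp
  have hvA0 : v A ≠ 0 := (Valuation.ne_zero_iff v).mpr hA
  have hvB0 : v B ≠ 0 := (Valuation.ne_zero_iff v).mpr hB
  have hvC0 : v C ≠ 0 := (Valuation.ne_zero_iff v).mpr hC0
  have hlx2 : WithZero.log (v (x + 2)) = 2 * WithZero.log (v B) := by
    rw [hxB, map_pow, WithZero.log_pow, nsmul_eq_mul]; push_cast; ring
  have hlx3 : WithZero.log (v (x - 3)) = 2 * WithZero.log (v C) := by
    rw [hxC, map_mul, map_pow, hvα, one_mul, WithZero.log_pow, nsmul_eq_mul]; push_cast; ring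
  have hlx : WithZero.log (v x) = 2 * WithZero.log (v A) := by
    rw [hxA, map_mul, map_pow, hvα, one_mul, WithZero.log_pow, nsmul_eq_mul]; push_cast; ring
  have hvx0 : v x ≠ 0 := (Valuation.ne_zero_iff v).mpr hx0
  have hvx30 : v (x - 3) ≠ 0 := (Valuation.ne_zero_iff v).mpr hx3
  have hxB' : ((αO : 𝓞 K) : K) * A ^ 2 + 2 = B ^ 2 := by rw [← hxA]; exact hxB
  have hxC' : ((αO : 𝓞 K) : K) * A ^ 2 - 3 = ((αO : 𝓞 K) : K) * C ^ 2 := by rw [← hxA]; exact hxC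
  rcases lt_trichotomy (WithZero.log (v A)) 0 with hlt | heq | hgt
  · -- `ord₂ A ≥ 1`: `v x ≤ exp(-2) < v 2`, so `v(x + 2) = v 2` has odd log
    have hvx : v x < v 2 := by
      rw [← WithZero.exp_log hvx0, hlx, hv2, WithZero.exp_lt_exp]; omega
    have h := congrArg WithZero.log (v.map_add_eq_of_lt_right hvx)
    rw [hlx2, hv2, WithZero.log_exp] at h
    omega
  · -- `ord₂ A = 0`
    have hvA : v A = 1 := by rw [← WithZero.exp_log hvA0, heq, WithZero.exp_zero]
    have hvx : v x = 1 := by rw [← WithZero.exp_log hvx0, hlx, heq, mul_zero, WithZero.exp_zero]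
    have hvx2 : v (x + 2) = 1 := by
      rw [v.map_add_eq_of_lt_left (by rw [hvx, hv2, ← WithZero.exp_zero, WithZero.exp_lt_exp]; norm_num)]
      exact hvx
    have hvB : v B = 1 := by
      have h := congrArg WithZero.log hvx2
      rw [hlx2, WithZero.log_one] at h
      rw [← WithZero.exp_log hvB0, show WithZero.log (v B) = 0 by omega, WithZero.exp_zero]
    have hvx3 : v (x - 3) ≤ 1 := v.map_sub_le hvx.le hv3
    have hvC : v C ≤ 1 := by
      have h := (log_nonpos_iff hvx30).mpr hvx3
      rw [hlx3] at h
      exact (log_nonpos_iff hvC0).mp (by omega)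
    obtain ⟨A₁, dA, hdA, hAd, hA₁⟩ := exists_odd_int_mul_eq hvA.le
    obtain ⟨B₁, dB, hdB, hBd, hB₁⟩ := exists_odd_int_mul_eq hvB.le
    obtain ⟨C₁, dC, hdC, hCd, -⟩ := exists_odd_int_mul_eq hvC
    have hA₁' := hA₁ hvA
    have hB₁' := hB₁ hvB
    have hAd' : A * (dA : K) = algebraMap (𝓞 K) K A₁ := hAd
    have hBd' : B * (dB : K) = algebraMap (𝓞 K) K B₁ := hBd
    have hCd' : C * (dC : K) = algebraMap (𝓞 K) K C₁ := hCd
    have hxB'' : algebraMap (𝓞 K) K αO * A ^ 2 + 2 = B ^ 2 := hxB'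
    have hxC'' : algebraMap (𝓞 K) K αO * A ^ 2 - 3 = algebraMap (𝓞 K) K αO * C ^ 2 := hxC'
    have h1O : αO * (A₁ * dB * dC) ^ 2 + 2 * ((dA : 𝓞 K) * dB * dC) ^ 2 = (B₁ * dA * dC) ^ 2 := by
      apply RingOfIntegers.coe_injective
      simp only [map_add, map_mul, map_pow, map_ofNat, map_intCast]
      rw [← hAd', ← hBd']
      linear_combination ((dA : K) * dB * dC) ^ 2 * hxB''
    have h2O : αO * (A₁ * dB * dC) ^ 2 - 3 * ((dA : 𝓞 K) * dB * dC) ^ 2 = αO * (C₁ * dA * dB) ^ 2 := by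
      apply RingOfIntegers.coe_injective
      simp only [map_sub, map_mul, map_pow, map_ofNat, map_intCast]
      rw [← hAd', ← hCd']
      linear_combination ((dA : K) * dB * dC) ^ 2 * hxC''
    have he : ψ ((dA : 𝓞 K) * dB * dC) * ψ ((dA : 𝓞 K) * dB * dC) = 1 := by
      have h := ψ_intCast_sq_eq_one ψ ((hdA.mul hdB).mul hdC)
      push_cast at h
      exact h
    exact core_main ψ hn hαψ
      (mul_not_mem_span_two (mul_not_mem_span_two hA₁' (intCast_not_mem_span_two ψ hdB))
        (intCast_not_mem_span_two ψ hdC))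
      (mul_not_mem_span_two (mul_not_mem_span_two hB₁' (intCast_not_mem_span_two ψ hdA))
        (intCast_not_mem_span_two ψ hdC))
      he h1O h2O
  · -- `ord₂ A = -M < 0`, `M ≥ 1`: rescale `A, B` by `2^M`
    obtain ⟨M, hM⟩ : ∃ M : ℕ, WithZero.log (v A) = M :=
      ⟨(WithZero.log (v A)).toNat, (Int.toNat_of_nonneg hgt.le).symm⟩
    have hM1 : 1 ≤ M := by omega
    have hvx : v x = WithZero.exp (2 * (M : ℤ)) := by rw [← WithZero.exp_log hvx0, hlx, hM]
    have hvx2 : v (x + 2) = v x :=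
      v.map_add_eq_of_lt_left (by rw [hvx, hv2, WithZero.exp_lt_exp]; omega)
    have hlB : WithZero.log (v B) = M := by
      have h := congrArg WithZero.log hvx2; rw [hlx2, hvx, WithZero.log_exp] at h; omega
    have hunit : ∀ Z : K, WithZero.log (v Z) = M → v Z ≠ 0 → v (Z * 2 ^ M) = 1 := by
      intro Z hZ hZ0
      have hne : v (Z * 2 ^ M) ≠ 0 := by
        rw [map_mul, map_pow, hv2]; exact mul_ne_zero hZ0 (pow_ne_zero _ (by simp))
      rw [← WithZero.exp_log hne, ← WithZero.exp_zero]
      congr 1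
      rw [map_mul, map_pow, WithZero.log_mul hZ0 (pow_ne_zero _ (by rw [hv2]; simp)), WithZero.log_pow, hv2,
        WithZero.log_exp, hZ, nsmul_eq_mul]
      ring
    have hvA₀ := hunit A hM hvA0
    have hvB₀ := hunit B hlB hvB0
    obtain ⟨A₁, dA, hdA, hAd, hA₁⟩ := exists_odd_int_mul_eq hvA₀.le
    obtain ⟨B₁, dB, hdB, hBd, hB₁⟩ := exists_odd_int_mul_eq hvB₀.le
    have hA₁' := hA₁ hvA₀
    have hB₁' := hB₁ hvB₀
    have e4 : (4 : K) ^ M = (2 ^ M) ^ 2 := by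
      rw [← pow_mul, mul_comm, pow_mul]; norm_num
    have hAd' : A * 2 ^ M * (dA : K) = algebraMap (𝓞 K) K A₁ := hAd
    have hBd' : B * 2 ^ M * (dB : K) = algebraMap (𝓞 K) K B₁ := hBd
    have hxB'' : algebraMap (𝓞 K) K αO * A ^ 2 + 2 = B ^ 2 := hxB'
    have h1O : αO * (A₁ * dB) ^ 2 + 2 * 4 ^ M * ((dA : 𝓞 K) * dB) ^ 2 = (B₁ * dA) ^ 2 := by
      apply RingOfIntegers.coe_injective
      simp only [map_add, map_mul, map_pow, map_ofNat, map_intCast]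
      rw [← hAd', ← hBd', e4]
      linear_combination ((dA : K) * dB * 2 ^ M) ^ 2 * hxB''
    exact core_neg ψ hn hαψ (mul_not_mem_span_two hA₁' (intCast_not_mem_span_two ψ hdB))
      (mul_not_mem_span_two hB₁' (intCast_not_mem_span_two ψ hdA)) hM1 h1O

end TwoAdic

/-! ### The images of the representatives in `𝓞/4` -/

/-- `ψ(η_i) = ηQ i`. [folklore] -/
theorem ψ_unitη (ψ : 𝓞 K →+* Q4) (hψ : ψ θint = t) (i : Fin 5) :
    ψ ((unitη i : (𝓞 K)ˣ) : 𝓞 K) = ηQ i := by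
  fin_cases i <;>
    simp [unitη, unitη₁, unitη₂, unitη₃, unitη₄, unitθ, Units.val_mkOfMulEqOne, ηQ, map_sub, map_add,
      map_neg, map_mul, map_pow, map_ofNat, map_one, hψ]

/-- **`ψ(rep n) = repQ n`.** [folklore] -/
theorem ψ_rep (ψ : 𝓞 K →+* Q4) (hψ : ψ θint = t) (n : Fin 32) :
    ψ ((rep n : (𝓞 K)ˣ) : 𝓞 K) = repQ n := by
  rw [rep, Units.coe_prod, map_prod, repQ_eq_prod]
  refine Finset.prod_congr rfl fun i _ => ?_
  rw [Units.val_pow_eq_pow_val, map_pow, ψ_unitη ψ hψ]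

/-! ### Assembly -/

/-- **The norm-`1` `2`-descent statement for `480a1` over `ℚ(ζ₁₁)⁺`.** For every `K`-point `(x, y)`,
`y ≠ 0`, of `y² = x(x + 2)(x - 3)` such that `N_{K/ℚ}(x)` and `N_{K/ℚ}(x + 2)` are rational squares,
`x` and `x + 2` are squares in `K`. Proof: `x + 2 = B²` by the real places (`x_add_two_eq_sq`);
`x = uA²` with `u = rep n` of even weight (`exists_rep_mul_sq_x`); if `n ≠ 0` then `n` is one of the
fifteen candidates and the `2`-adic obstruction (`two_adic_obstruction`) applies; so `n = 0`, `x = A²`.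
[folklore] -/
theorem normDescent {x y : K} (hE : y ^ 2 = x * (x + 2) * (x - 3)) (hy : y ≠ 0)
    (hNx : IsSquare (Algebra.norm ℚ x)) (hNx2 : IsSquare (Algebra.norm ℚ (x + 2))) :
    IsSquare x ∧ IsSquare (x + 2) := by
  obtain ⟨B, hB0, hxB⟩ := x_add_two_eq_sq hE hy hNx2
  obtain ⟨n, A, hA0, hxA, hwt⟩ := exists_rep_mul_sq_x hE hy hNx
  obtain ⟨ψ, hψ⟩ := exists_ψ₄
  have hn : n = 0 := by
    by_contra hne
    exact two_adic_obstruction ψ (unit_not_mem_span_two (rep n)) (mem_candN n hne hwt) (ψ_rep ψ hψ n)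
      hE hy hA0 hB0 hxA hxB
  subst hn
  rw [rep_zero] at hxA
  refine ⟨⟨A, ?_⟩, ⟨B, by rw [hxB, pow_two]⟩⟩
  rw [hxA]; simp [pow_two]

/-! ### Transport to any quintic field generated by a root of `f` -/

section Transport

variable {K' : Type*} [Field K'] [Algebra ℚ K']

/-- `f(z) = z⁵ + z⁴ - 4z³ - 3z² + 3z + 1` as the value of `aeval`. [folklore] -/
theorem aeval_quinticPolyRat (z : K') :
    aeval z quinticPolyRat = z ^ 5 + z ^ 4 - 4 * z ^ 3 - 3 * z ^ 2 + 3 * z + 1 := by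
  refine (aeval_map_algebraMap ℚ z quinticPoly).trans ?_
  rw [quinticPoly]
  simp only [map_add, map_sub, map_pow, map_mul, aeval_X, map_ofNat, map_one]

/-- **The homomorphism `K = ℚ[X]/(f) → K'`, `θ ↦ θ'`**, for a root `θ'` of `f` in a `ℚ`-algebra `K'`.
[folklore] -/
def algHomOfRoot {θ' : K'} (h : θ' ^ 5 + θ' ^ 4 - 4 * θ' ^ 3 - 3 * θ' ^ 2 + 3 * θ' + 1 = 0) :
    K →ₐ[ℚ] K' :=
  AdjoinRoot.liftAlgHom quinticPolyRat (Algebra.ofId ℚ K') θ'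
    (show aeval θ' quinticPolyRat = 0 by rw [aeval_quinticPolyRat, h])

/-- `algHomOfRoot h θ = θ'`. [folklore] -/
theorem algHomOfRoot_θ {θ' : K'} (h : θ' ^ 5 + θ' ^ 4 - 4 * θ' ^ 3 - 3 * θ' ^ 2 + 3 * θ' + 1 = 0) :
    algHomOfRoot h θ = θ' :=
  AdjoinRoot.liftAlgHom_root _ _ _ _

/-- **`K ≃ₐ[ℚ] K'` for every quintic extension `K'/ℚ` containing a root of `f`**: the homomorphism
`θ ↦ θ'` out of the field `K` is injective, hence bijective by `[K : ℚ] = 5 = [K' : ℚ]`. [folklore] -/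
def algEquivOfRoot (h5 : Module.finrank ℚ K' = 5) {θ' : K'}
    (h : θ' ^ 5 + θ' ^ 4 - 4 * θ' ^ 3 - 3 * θ' ^ 2 + 3 * θ' + 1 = 0) : K ≃ₐ[ℚ] K' :=
  haveI : FiniteDimensional ℚ K' := Module.finite_of_finrank_eq_succ h5
  AlgEquiv.ofBijective (algHomOfRoot h)
    ⟨(algHomOfRoot h).toRingHom.injective,
     (LinearMap.injective_iff_surjective_of_finrank_eq_finrank (f := (algHomOfRoot h).toLinearMap)
        (by rw [finrank_K, h5])).mp (algHomOfRoot h).toRingHom.injective⟩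

/-- `algEquivOfRoot h5 h θ = θ'`. [folklore] -/
theorem algEquivOfRoot_θ (h5 : Module.finrank ℚ K' = 5) {θ' : K'}
    (h : θ' ^ 5 + θ' ^ 4 - 4 * θ' ^ 3 - 3 * θ' ^ 2 + 3 * θ' + 1 = 0) : algEquivOfRoot h5 h θ = θ' :=
  algHomOfRoot_θ h

/-- Squares are preserved by ring isomorphisms. [folklore] -/
theorem isSquare_map_of_isSquare (g : K ≃ₐ[ℚ] K') {z : K} (hz : IsSquare z) : IsSquare (g z) := by
  obtain ⟨r, hr⟩ := hz
  exact ⟨g r, by rw [hr, map_mul]⟩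

/-- **Transport of `normDescent` along `K ≃ₐ[ℚ] K'`** (the curve equation, the norms `N_{·/ℚ}` and
squareness are invariant under `ℚ`-algebra isomorphisms). [folklore] -/
theorem normDescent_of_algEquiv (g : K ≃ₐ[ℚ] K') {x y : K'} (hE : y ^ 2 = x * (x + 2) * (x - 3))
    (hy : y ≠ 0) (hNx : IsSquare (Algebra.norm ℚ x)) (hNx2 : IsSquare (Algebra.norm ℚ (x + 2))) :
    IsSquare x ∧ IsSquare (x + 2) := by
  set x₀ := g.symm x with hx₀
  set y₀ := g.symm y with hy₀
  have hx : x = g x₀ := (g.apply_symm_apply x).symm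
  have hyy : y = g y₀ := (g.apply_symm_apply y).symm
  have hE₀ : y₀ ^ 2 = x₀ * (x₀ + 2) * (x₀ - 3) := by
    apply g.injective
    rw [map_pow, map_mul, map_mul, map_add, map_sub, map_ofNat, map_ofNat, ← hx, ← hyy, hE]
  have hy₀' : y₀ ≠ 0 := fun h => hy (by rw [hyy, h, map_zero])
  have hN₀ : Algebra.norm ℚ x₀ = Algebra.norm ℚ x := by
    rw [hx, Algebra.norm_eq_of_algEquiv g x₀]
  have hN₂ : Algebra.norm ℚ (x₀ + 2) = Algebra.norm ℚ (x + 2) := by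
    rw [← Algebra.norm_eq_of_algEquiv g (x₀ + 2), map_add, map_ofNat, ← hx]
  obtain ⟨h1, h2⟩ := normDescent hE₀ hy₀' (hN₀ ▸ hNx) (hN₂ ▸ hNx2)
  refine ⟨hx ▸ isSquare_map_of_isSquare g h1, ?_⟩
  have : x + 2 = g (x₀ + 2) := by rw [map_add, map_ofNat, ← hx]
  rw [this]
  exact isSquare_map_of_isSquare g h2

/-- **The norm-`1` `2`-descent of `480a1` over ANY quintic extension `K'/ℚ` generated by a root of
`f = X⁵ + X⁴ - 4X³ - 3X² + 3X + 1`** (i.e. over any copy of `ℚ(ζ₁₁)⁺`, in whatever form it presents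
itself — e.g. as a subfield of `ℚ(ζ₂₆₅₁)`): points `(x, y)`, `y ≠ 0`, of `y² = x(x+2)(x-3)` with
`N(x)`, `N(x + 2) ∈ ℚ²` have `x`, `x + 2 ∈ K'²`. [folklore] -/
theorem normDescent_of_root (h5 : Module.finrank ℚ K' = 5) {θ' : K'}
    (hθ' : θ' ^ 5 + θ' ^ 4 - 4 * θ' ^ 3 - 3 * θ' ^ 2 + 3 * θ' + 1 = 0) {x y : K'}
    (hE : y ^ 2 = x * (x + 2) * (x - 3)) (hy : y ≠ 0) (hNx : IsSquare (Algebra.norm ℚ x))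
    (hNx2 : IsSquare (Algebra.norm ℚ (x + 2))) : IsSquare x ∧ IsSquare (x + 2) :=
  normDescent_of_algEquiv (algEquivOfRoot h5 hθ') hE hy hNx hNx2

end Transport

end CyclicQuintic11

end Literature.NumberTheory.NumberFields

end
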